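import Summits.BirchSwinnertonDyer.Rank1Residual.X11b.PadicComplexTransport
import Summits.BirchSwinnertonDyer.Rank1Residual.X11b.UnrIntegersValuationRing
import Summits.BirchSwinnertonDyer.Rank1Residual.X11b.HalvesReceptacle
import Literature.NumberTheory.PAdicHodge.AxSenTateRelative
import HarnessLib

/-!
# X11b · S29 K3 (T5 = `hAST`): an element of `ℂ_[p]` fixed by every continuous extension of every
# automorphism of `ℚ̄_p` fixing the roots of unity of order prime to `p` lies in `Frac R₀`
# (every prime `p`; theorems only)

HONEST FRAMING (cell `b2b-bsdres`, run/shared/lean/b2b/bsd-rank1-residual/, verbatim in every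
file): the goal of the cell is to DELETE the COMBINATION-SHAPED residual classes of the
Birch–Swinnerton-Dyer formula for ALL analytic-rank `≤ 1` elliptic curves over `ℚ` — assembled
STRICTLY from published theorems — so that the rank-`≤ 1` remainder becomes exactly the
CONSTRUCTION-SHAPED classes, which are TYPED, NOT attempted. This is not "finishing BSD". Team
`x11b3` = N8/O2 (X11b at `p = 3`): research routes; nothing booked; no label change; O2 OPEN; the
node of record `Three.HsiehDescentAt₃` is UNCHANGED by this file (sub-target S29 RE-EXPRESSES (t)
⟸ (VR); lead GEN 8 R9-8 / R9-25 / R9-30).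

PROVENANCE: S29 kernel package K3 = [T2 T3 T4 T5] (lead R9-25/R9-27/R9-30), item (T5) = the
hypothesis `hAST` of x11b3-p7's K4 (`HOME/b2b-bsdres-x11b3-p7/s25/K4-INTERFACES.md`), seat
`b2b-bsdres-x11b3-p1` GEN 3. This file PROVES that hypothesis, for every prime `p`, in exactly
p7's currency: `D = PadicAlgCl p ≃ₐ[ℚ_[p]] PadicAlgCl p`, an element `τ` acting on `ℂ_[p]` through
ANY continuous ring endomorphism `T` extending it, `INERTIA(τ) :=` "`τ` fixes every `ζ ∈ ℚ̄_p` with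
`ζ ^ m = 1`, `0 < m`, `p ∤ m`", and the target `Subfield.closure (unrIntegers p)` (`= Frac R₀`,
route R1's `R1.*` API, `X11b/UnrIntegersValuationRing.lean`).

## What is proved

* `algebraMap_padic_mem_fracUnr`, `coe_mem_fracUnr_of_pow_eq_one`: `ℚ_[p] ⊆ Frac R₀` and the
  prime-to-`p` roots of unity of `ℚ̄_p` lie in `Frac R₀`.
* `coe_mem_fracUnr_of_mem_adjoin_rootsOfUnity`: the field `ℚ_p(μ′) = ℚ_p^{ur} ⊆ ℚ̄_p` generated by
  those roots of unity maps into `Frac R₀` (an `IntermediateField.adjoin_le_iff` argument).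
* **`mem_fracUnr_of_forall_inertia_fixed`** (= `hAST`): if `x ∈ ℂ_[p]` satisfies `T x = x` for every
  `τ ∈ D` fixing the prime-to-`p` roots of unity and every continuous `T : ℂ_[p] →+* ℂ_[p]` extending
  `τ`, then `x ∈ Subfield.closure (unrIntegers p)`; and `mem_unrIntegers_of_forall_inertia_fixed`
  (the same with `‖x‖ ≤ 1 ⟹ x ∈ R₀`, by `R1.mem_unrIntegers_of_mem_fracUnr`); and the FAMILY forms
  `mem_fracUnr_of_forall_inertia_fixed_family` / `mem_unrIntegers_of_forall_inertia_fixed_family` (a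
  fixed family `T τ` of continuous extensions, K4-INTERFACES v3 "family-T"; by uniqueness of
  continuous extensions `ringHom_padicComplex_ext`).

Proof: pull `x` back along the bi-continuous `e : ℂ_{ℚ_p} ≃+* ℂ_[p]` of
`X11b/PadicComplexTransport` (`exists_ringEquiv_padicComplex`); every `σ ∈ Γ_{ℚ_p}` fixing the
intermediate field `L = ℚ_p(μ′)` of the tree's `NormedAlgClosure ℚ_[p]` satisfies `INERTIA`, and its
transported continuous extension `T_σ = e σ e⁻¹` (`exists_continuous_ringHom_padicComplex_extending`)
fixes `x`, so `σ` fixes `e⁻¹ x`; by the tree's **Ax–Sen–Tate theorem for an arbitrary intermediate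
field** (`PAdicHodge.CompletedAlgClosure.fixedPoints_rel_eq_closure`, Ax 1970 / Tate 1967 §3.3)
`e⁻¹ x` lies in the closure of `L` in `ℂ_{ℚ_p}`; `e` is a homeomorphism, `e(L) ⊆ Frac R₀`, and
`Frac R₀` is closed in `ℂ_[p]` (`R1.isClosed_fracUnr`). No definition, no named fact, no `sorry`.

References: [Ax1970]; [Tate1967] §3.3; [FontaineOuyang2022] §3.1; [Castella2018] §3 p. 9 (`R₀`).
-/

noncomputable section

open Field ValuativeRel UniformSpace Filter
open scoped Topology IntermediateField

namespace Summit.BirchSwinnertonDyer.Rank1Residual.X11b.PadicComplexTransport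

open Literature.NumberTheory.PAdicHodge
open Literature.NumberTheory.GaloisRepresentations
open Literature.NumberTheory.GaloisRepresentations.IsNonarchimedeanLocalField
open Literature.NumberTheory.EllipticCurves

variable {p : ℕ} [Fact p.Prime]

/-! ### §1 `ℚ_p(μ′) ⊆ Frac R₀` -/

variable (p) in
/-- `ℚ_[p] ⊆ Frac R₀ ⊆ ℂ_[p]`: `k = u / p^n` with `u ∈ ℤ_p ⊆ R₀` (`Halves.algebraMap_coe_padicInt_mem_unrIntegers`)
and `p ∈ R₀`. [cite: Castella2018, §3 (p. 9)] -/
theorem algebraMap_padic_mem_fracUnr (k : ℚ_[p]) :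
    ((k : PadicAlgCl p) : ℂ_[p]) ∈ Subfield.closure (unrIntegers p : Set ℂ_[p]) := by
  have hp : p.Prime := Fact.out
  have hk : ((k : PadicAlgCl p) : ℂ_[p]) = algebraMap ℚ_[p] ℂ_[p] k :=
    (IsScalarTower.algebraMap_apply ℚ_[p] (PadicAlgCl p) ℂ_[p] k).symm
  rw [hk]
  -- `k * p^n ∈ ℤ_p` for some `n`
  obtain ⟨n, hn⟩ : ∃ n : ℕ, ‖k * (p : ℚ_[p]) ^ n‖ ≤ 1 := by
    obtain ⟨n, hn⟩ := pow_unbounded_of_one_lt ‖k‖ (show (1 : ℝ) < p by exact_mod_cast hp.one_lt)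
    refine ⟨n, ?_⟩
    have hp0 : (0 : ℝ) < p := by exact_mod_cast hp.pos
    rw [norm_mul, norm_pow, Padic.norm_p, inv_pow, ← div_eq_mul_inv, div_le_one (pow_pos hp0 n)]
    exact hn.le
  set u : ℤ_[p] := ⟨k * (p : ℚ_[p]) ^ n, hn⟩ with hu_def
  have hu : (u : ℚ_[p]) = k * (p : ℚ_[p]) ^ n := rfl
  have hpn : (p : ℚ_[p]) ^ n ≠ 0 := pow_ne_zero _ (Nat.cast_ne_zero.2 hp.ne_zero)
  have hk' : k = (u : ℚ_[p]) / (p : ℚ_[p]) ^ n := by rw [hu, mul_div_cancel_right₀ _ hpn]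
  rw [hk', map_div₀, map_pow, map_natCast]
  exact div_mem (Subfield.subset_closure (Halves.algebraMap_coe_padicInt_mem_unrIntegers p u))
    (pow_mem (Subfield.subset_closure (by exact_mod_cast intCast_mem_unrIntegers (p := p) (p : ℤ))) n)

variable (p) in
/-- A root of unity of order prime to `p` in `ℚ̄_p` lies in `Frac R₀` (indeed in `R₀`,
`mem_unrIntegers_of_pow_eq_one`). [cite: Castella2018, §3 (p. 9)] -/
theorem coe_mem_fracUnr_of_pow_eq_one {ζ : PadicAlgCl p} {m : ℕ} (hm : 0 < m) (hpm : ¬ p ∣ m)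
    (hζ : ζ ^ m = 1) : (ζ : ℂ_[p]) ∈ Subfield.closure (unrIntegers p : Set ℂ_[p]) :=
  Subfield.subset_closure (mem_unrIntegers_of_pow_eq_one hm hpm
    (by rw [PadicComplex.coe_eq, ← map_pow, hζ, map_one]))

variable [IsNonarchimedeanLocalField ℚ_[p]]

variable (p) in
/-- **`ℚ_p(μ′) ⊆ Frac R₀`.** Every element of the intermediate field of `ℚ̄_p / ℚ_p` generated by the
roots of unity of order prime to `p` (the maximal unramified extension `ℚ_p^{ur}`, Serre LF IV §4
Cor. 2 to Prop. 16) maps into `Frac R₀ ⊆ ℂ_[p]`: the elements of the tree's `NormedAlgClosure ℚ_[p]`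
mapping into the subfield `Frac R₀` form an intermediate field containing the generators.
[cite: SerreLocalFields1979, Ch. IV §4 Cor. 2 to Prop. 16] -/
theorem coe_mem_fracUnr_of_mem_adjoin_rootsOfUnity {y : NormedAlgClosure ℚ_[p]}
    (hy : y ∈ IntermediateField.adjoin ℚ_[p]
      {ζ : NormedAlgClosure ℚ_[p] | ∃ m : ℕ, 0 < m ∧ ¬ p ∣ m ∧ ζ ^ m = 1}) :
    ((NormedAlgClosure.toAlgClosure y : PadicAlgCl p) : ℂ_[p]) ∈
      Subfield.closure (unrIntegers p : Set ℂ_[p]) := by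
  -- the ring map `NormedAlgClosure ℚ_[p] → ℂ_[p]`
  set f : NormedAlgClosure ℚ_[p] →+* ℂ_[p] :=
    (algebraMap (PadicAlgCl p) ℂ_[p]).comp
      (NormedAlgClosure.toAlgClosure (F := ℚ_[p])).toRingEquiv.toRingHom with hf
  have hf_apply : ∀ z, f z = ((NormedAlgClosure.toAlgClosure z : PadicAlgCl p) : ℂ_[p]) := fun _ => rfl
  -- the elements mapping into `Frac R₀` form an intermediate field
  set M : IntermediateField ℚ_[p] (NormedAlgClosure ℚ_[p]) :=
    ((Subfield.closure (unrIntegers p : Set ℂ_[p])).comap f).toIntermediateField fun k => by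
      rw [Subfield.mem_comap, hf_apply, AlgEquiv.commutes]
      exact algebraMap_padic_mem_fracUnr p k
    with hM
  have hle : IntermediateField.adjoin ℚ_[p]
      {ζ : NormedAlgClosure ℚ_[p] | ∃ m : ℕ, 0 < m ∧ ¬ p ∣ m ∧ ζ ^ m = 1} ≤ M := by
    rw [IntermediateField.adjoin_le_iff]
    rintro ζ ⟨m, hm, hpm, hζ⟩
    change ζ ∈ (Subfield.closure (unrIntegers p : Set ℂ_[p])).comap f
    rw [Subfield.mem_comap, hf_apply]
    exact coe_mem_fracUnr_of_pow_eq_one p hm hpm (by rw [← map_pow, hζ, map_one])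
  have hyM := hle hy
  change y ∈ (Subfield.closure (unrIntegers p : Set ℂ_[p])).comap f at hyM
  rwa [Subfield.mem_comap, hf_apply] at hyM

/-! ### §2 `hAST` -/

variable (p) in
/-- **S29 K4's hypothesis `hAST`, proved** (Ax–Sen–Tate for `ℚ_p^{ur}`, transported to `ℂ_[p]`).
Let `x ∈ ℂ_[p]` be fixed by every continuous ring endomorphism `T` of `ℂ_[p]` extending an
automorphism `τ ∈ Aut(ℚ̄_p/ℚ_p)` which fixes all roots of unity of order prime to `p`. Then
`x ∈ Frac R₀ = Subfield.closure (unrIntegers p)`, the closure of `ℚ_p^{ur}` in `ℂ_[p]`.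
Proof: with `e : ℂ_{ℚ_p} ≃+* ℂ_[p]` (`exists_ringEquiv_padicComplex`), every `σ ∈ Γ_{ℚ_p}` fixing
`L = ℚ_p(μ′)` has a continuous extension `T_σ = e σ e⁻¹` to `ℂ_[p]` extending `σ`
(`exists_continuous_ringHom_padicComplex_extending`), hence `σ • e⁻¹ x = e⁻¹ x`; by Ax–Sen–Tate for
the intermediate field `L` (`PAdicHodge.CompletedAlgClosure.fixedPoints_rel_eq_closure`) `e⁻¹ x` is
in the closure of `L`, whose `e`-image lies in the CLOSED subfield `Frac R₀` (`R1.isClosed_fracUnr`,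
`coe_mem_fracUnr_of_mem_adjoin_rootsOfUnity`). [cite: Tate1967, §3.3] [cite: Ax1970, Thm. 1] -/
theorem mem_fracUnr_of_forall_inertia_fixed (x : ℂ_[p])
    (hx : ∀ (τ : PadicAlgCl p ≃ₐ[ℚ_[p]] PadicAlgCl p) (T : ℂ_[p] →+* ℂ_[p]), Continuous T →
      (∀ y : PadicAlgCl p, T (y : ℂ_[p]) = ((τ y : PadicAlgCl p) : ℂ_[p])) →
      (∀ ζ : PadicAlgCl p, (∃ m : ℕ, 0 < m ∧ ¬ p ∣ m ∧ ζ ^ m = 1) → τ ζ = ζ) → T x = x) :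
    x ∈ Subfield.closure (unrIntegers p : Set ℂ_[p]) := by
  obtain ⟨c, hc, e, he_coe, -, heu, hesu⟩ := exists_ringEquiv_padicComplex p
  set L : IntermediateField ℚ_[p] (NormedAlgClosure ℚ_[p]) := IntermediateField.adjoin ℚ_[p]
      {ζ : NormedAlgClosure ℚ_[p] | ∃ m : ℕ, 0 < m ∧ ¬ p ∣ m ∧ ζ ^ m = 1} with hL
  set x' : CompletedAlgClosure ℚ_[p] := e.symm x with hx'
  -- every `σ` fixing `L` fixes `x'`
  have hfix : ∀ σ : absoluteGaloisGroup ℚ_[p], (∀ y ∈ L, σ • y = y) → σ • x' = x' := by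
    intro σ hσ
    obtain ⟨T, hT, hTτ, hTe⟩ :=
      exists_continuous_ringHom_padicComplex_extending e heu.continuous hesu.continuous he_coe σ
    have hin : ∀ ζ : PadicAlgCl p, (∃ m : ℕ, 0 < m ∧ ¬ p ∣ m ∧ ζ ^ m = 1) →
        absoluteGaloisGroup.toAlgEquiv ℚ_[p] σ ζ = ζ := by
      rintro ζ ⟨m, hm, hpm, hζ⟩
      have hζ' : (NormedAlgClosure.toAlgClosure (F := ℚ_[p])).symm ζ ∈ L :=
        IntermediateField.subset_adjoin _ _ ⟨m, hm, hpm, by rw [← map_pow, hζ, map_one]⟩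
      have h1 := congrArg (NormedAlgClosure.toAlgClosure (F := ℚ_[p])) (hσ _ hζ')
      rwa [NormedAlgClosure.smul_eq_toAlgEquiv, AlgEquiv.apply_symm_apply] at h1
    have hTx : T x = x := hx (absoluteGaloisGroup.toAlgEquiv ℚ_[p] σ) T hT hTτ hin
    apply e.injective
    rw [← hTe, hx', RingEquiv.apply_symm_apply, hTx]
  -- Ax–Sen–Tate: `x'` is in the closure of `L`
  have hmem : x' ∈ closure ((fun y : NormedAlgClosure ℚ_[p] => (y : CompletedAlgClosure ℚ_[p])) ''
      (L : Set (NormedAlgClosure ℚ_[p]))) := by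
    rw [← CompletedAlgClosure.fixedPoints_rel_eq_closure L]
    exact hfix
  -- push forward along the homeomorphism `e`
  have himage : e '' ((fun y : NormedAlgClosure ℚ_[p] => (y : CompletedAlgClosure ℚ_[p])) ''
      (L : Set (NormedAlgClosure ℚ_[p]))) ⊆ Subfield.closure (unrIntegers p : Set ℂ_[p]) := by
    rintro _ ⟨_, ⟨y, hy, rfl⟩, rfl⟩
    rw [he_coe]
    exact coe_mem_fracUnr_of_mem_adjoin_rootsOfUnity p hy
  have hx_eq : x = e x' := by rw [hx', RingEquiv.apply_symm_apply]
  rw [hx_eq]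
  exact R1.isClosed_fracUnr.closure_subset_iff.2 himage
    (image_closure_subset_closure_image heu.continuous ⟨x', hmem, rfl⟩)

variable (p) in
/-- **Integral form of `hAST`**: under the same hypothesis, if moreover `‖x‖ ≤ 1` then
`x ∈ R₀ = unrIntegers p` (`R₀` is the valuation ring of `Frac R₀`,
`R1.mem_unrIntegers_of_mem_fracUnr`). This is the form that puts the coefficients of an
inertia-invariant bounded power series into `R₀⟦T⟧`. [cite: Castella2018, §3 (p. 9)] -/
theorem mem_unrIntegers_of_forall_inertia_fixed (x : ℂ_[p]) (hx1 : ‖x‖ ≤ 1)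
    (hx : ∀ (τ : PadicAlgCl p ≃ₐ[ℚ_[p]] PadicAlgCl p) (T : ℂ_[p] →+* ℂ_[p]), Continuous T →
      (∀ y : PadicAlgCl p, T (y : ℂ_[p]) = ((τ y : PadicAlgCl p) : ℂ_[p])) →
      (∀ ζ : PadicAlgCl p, (∃ m : ℕ, 0 < m ∧ ¬ p ∣ m ∧ ζ ^ m = 1) → τ ζ = ζ) → T x = x) :
    x ∈ unrIntegers p :=
  R1.mem_unrIntegers_of_mem_fracUnr (mem_fracUnr_of_forall_inertia_fixed p x hx) hx1

variable (p) in
/-- **`hAST` for a FIXED family of extensions** (the form in which K4-B/C consume it after fixing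
their family `T τ` of continuous extensions, x11b3-p7 `K4-INTERFACES.md` v3 "family-T"): if
`T τ x = x` for every `τ` fixing the prime-to-`p` roots of unity, then `x ∈ Frac R₀`. Reduced to
`mem_fracUnr_of_forall_inertia_fixed` by the uniqueness of continuous extensions
(`ringHom_padicComplex_ext`). [cite: Tate1967, §3.3] -/
theorem mem_fracUnr_of_forall_inertia_fixed_family
    (T : (PadicAlgCl p ≃ₐ[ℚ_[p]] PadicAlgCl p) → ℂ_[p] →+* ℂ_[p]) (hT : ∀ τ, Continuous (T τ))
    (hTτ : ∀ τ (y : PadicAlgCl p), T τ (y : ℂ_[p]) = ((τ y : PadicAlgCl p) : ℂ_[p])) (x : ℂ_[p])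
    (hx : ∀ τ : PadicAlgCl p ≃ₐ[ℚ_[p]] PadicAlgCl p,
      (∀ ζ : PadicAlgCl p, (∃ m : ℕ, 0 < m ∧ ¬ p ∣ m ∧ ζ ^ m = 1) → τ ζ = ζ) → T τ x = x) :
    x ∈ Subfield.closure (unrIntegers p : Set ℂ_[p]) := by
  refine mem_fracUnr_of_forall_inertia_fixed p x fun τ T' hT' hT'τ hin => ?_
  have h : T' = T τ := ringHom_padicComplex_ext hT' (hT τ) fun y => by rw [hT'τ, hTτ]
  rw [h]
  exact hx τ hin

variable (p) in
/-- Integral form of `mem_fracUnr_of_forall_inertia_fixed_family`: with `‖x‖ ≤ 1` moreover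
`x ∈ R₀ = unrIntegers p`. [cite: Castella2018, §3 (p. 9)] -/
theorem mem_unrIntegers_of_forall_inertia_fixed_family
    (T : (PadicAlgCl p ≃ₐ[ℚ_[p]] PadicAlgCl p) → ℂ_[p] →+* ℂ_[p]) (hT : ∀ τ, Continuous (T τ))
    (hTτ : ∀ τ (y : PadicAlgCl p), T τ (y : ℂ_[p]) = ((τ y : PadicAlgCl p) : ℂ_[p])) (x : ℂ_[p])
    (hx1 : ‖x‖ ≤ 1)
    (hx : ∀ τ : PadicAlgCl p ≃ₐ[ℚ_[p]] PadicAlgCl p,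
      (∀ ζ : PadicAlgCl p, (∃ m : ℕ, 0 < m ∧ ¬ p ∣ m ∧ ζ ^ m = 1) → τ ζ = ζ) → T τ x = x) :
    x ∈ unrIntegers p :=
  R1.mem_unrIntegers_of_mem_fracUnr (mem_fracUnr_of_forall_inertia_fixed_family p T hT hTτ x hx) hx1

end Summit.BirchSwinnertonDyer.Rank1Residual.X11b.PadicComplexTransport

end
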